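import Summits.RiemannHypothesis.RiemannHypothesis.Theses.WeilWindowFlow
import Summits.RiemannHypothesis.RiemannHypothesis.Theorems.WeilWindowFlowStrictUnderRH
import Summits.RiemannHypothesis.RiemannHypothesis.Theorems.WeilWindowFlowWindowLipschitzStubFormDomainPos
import Summits.RiemannHypothesis.RiemannHypothesis.Theorems.WeilWindowFlowWindowLipschitzStubGroundStateEnergy
import Summits.RiemannHypothesis.RiemannHypothesis.Theorems.WeilWindowFlowWindowLipschitzStubEulerLagrange
import Summits.RiemannHypothesis.RiemannHypothesis.Theorems.WeilWindowFlowWindowLipschitzStubLocalizedCut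
import Summits.RiemannHypothesis.RiemannHypothesis.Theorems.WindowLipschitz.Negative.CutDontSqueezeFloors
import Literature.NumberTheory.LFunctions.WeilGroundState
import Literature.NumberTheory.LFunctions.WeilSemilocalCompactnessProofs
import Literature.NumberTheory.LFunctions.WeilWindowSuzukiAsymptoticProofs
import Literature.NumberTheory.LFunctions.WeilWindowSuzukiContinuityProofs
import Literature.NumberTheory.LFunctions.WeilWindowSuzukiProofs

/-!
# Disproof of `DiniLeakage` (crux `stmt-RiemannHypothesis-1038`, route WeilWindowFlow) — findings

The crux, with `ε = Literature.NumberTheory.LFunctions.weilGroundEnergy` (bottom of Weil's quadratic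
form on the window `[-a, a]`):

  `DiniLeakage : ∀ b₀ A, 0 < b₀ → b₀ ≤ A → ∃ K, ∀ a ∈ [b₀, A], ∀ η δ > 0, ∃ h ∈ (0, δ),
      ε a - ε (a + h) ≤ h * (K * ε a + η)`

i.e. the LOWER right Dini bound `liminf_{h → 0⁺} (ε a − ε (a+h))/h ≤ K ε(a)` with `K` uniform on
compact window ranges (`DiniBoundAt`, `diniLeakage_iff_diniShape` below is `Iff.rfl`).

## Findings (every `theorem` in this file is sorry-free; standing disprover, cycles 1–2; cycle-2 additions: items 7–10 and the sections "Calibration III" and "Targets" at the end)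

1. **Exact decomposition** (`diniLeakage_iff_pos_and_lowerRightLipschitz`):
   `DiniLeakage ↔ (∀ a > 0, 0 < ε a) ∧ LowerRightLipschitz`, where `LowerRightLipschitz` is the same
   Dini shape with the relative rate `K ε a` replaced by an absolute constant `L(b₀, A)`. Only the
   PROVED continuity of `ε` (`continuousAt_weilGroundEnergy`, Suzuki 2026 Thm 1.3, in the tree) is
   used. Hence a disproof has exactly two doors: (D1) a window `a₁ > 0` with `ε a₁ ≤ 0`;
   (D2) unbounded lower right difference quotients of `ε` on some compact range (a vertical right
   tangent, or a non-uniform family of steep points).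
2. **Calibration — the crux alone decides RH** (`riemannHypothesis_of_diniLeakage`,
   `summit_of_diniLeakage`): `DiniLeakage → RiemannHypothesis` with NO other route item — the
   Dini–Grönwall fence `mul_exp_le_of_diniBoundAt` (Mathlib's
   `image_le_of_liminf_slope_right_lt_deriv_boundary` with an exponential barrier) transports the
   proved coercive anchor `exists_weilGroundEnergy_pos` to every window, continuity being proved.
   So door (D1) is `¬RH ∨ (RH ∧ some window bottom is 0)`; nothing cheaper. Conversely
   `diniLeakage_iff_riemannHypothesis (h₁₀₄₃ : StrictUnderRH) (h₁₀₃₉ : WindowLipschitz)`: modulo the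
   two OTHER route items the crux is literally RH — it is not weaker than the summit.
3. **Load-bearing hypothesis `0 < b₀`** (`diniLeakage_false_without_b0_pos`, `not_diniLeakageUniformK`):
   letting the range start at `0` (one `K` on `(0, A]`, a fortiori one `K` for all windows) is FALSE:
   the fence bounds `ε` on `(0, a₁]` by `ε(a₁) e^{|K| a₁}`, against coercivity `ε(b) → +∞`
   (`weilQuadratic_coercive`, Bombieri 2000 Thm 12). Any proof must let `K` blow up as `b₀ → 0⁺`
   (true rate there: `K(a) ≍ 1/(a log(1/a))`, from `ε(a) = log(1/a) + O(1)`,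
   `Suzuki2026_thm_1_4_asymptotic_holds`). Uniformity as `A → ∞` is expected false as well
   (`K(a) ≍ c e^{2a}` from `ε(a) ≈ exp(−c e^{2a})`, Connes–Consani arXiv:2106.01715 §2.5) but that
   is RH-deep and not provable here.
4a. **Mutation: the slack `η` is decorative** (`diniLeakage_iff_eta0`): the `η`-free form
   `∃ h ∈ (0,δ), ε a − ε (a+h) ≤ h K ε a` is equivalent to the crux; `δ` and `0 < b₀` are not removable.
4. **The Dini shape alone forces neither sign nor continuity** (`diniShape_stepWitness`,
   `not_diniShape_forces_pos`): the antitone step `x ↦ if x < 1 then 1 else −1` (jump approached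
   from the LEFT) satisfies the shape with `K = 0`. So in `DiniGlue` the continuity input is
   load-bearing in the abstract — but it is a tree theorem for `ε`, which is what makes item 2 work.
5. **Why no refutation (door D2) was found — recorded for the provers.** By 1–2 a refutation short
   of `¬RH` must exhibit (D2). The window flow `a ↦ ε(a)` is non-analytic only where a prime power
   enters, `a = (log n)/2`. There the first-order gain of the entering term is
   `2Λ(n) n^{-1/2} k_φ(log n)`, `k_φ(2a − 2h) = ∫_{a−2h}^{a} φ(x) conj φ(x − log n) dx`, and for a
   window minimiser `φ` this is `o(h)`: minimisers of `½ E_{L_Δ} + compact` (the archimedean form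
   is half the 1-D logarithmic-Laplacian form plus a Hilbert–Schmidt perturbation, see the notes on
   item 1039) vanish at the edges like `(log 1/dist)^{-τ}` (Chen–Weth 2019; Feulefack–Jarohs–Weth
   arXiv:2010.10448 Thm 1.1), while concentrating mass `m` within `h` of an edge costs `≳ m log(1/h)`
   of archimedean energy against a prime gain `≤ 2Λ(n)n^{-1/2} m`. So prime entry is soft (no
   vertical tangent, not even a first-order kink); between entries the rescaled Rayleigh quotient
   (Suzuki 2026 (4.5)) depends on `a` only through `log(1/a)`, smooth kernels and the shifts
   `log n / a` acting on a fixed minimiser with `φ' ∈ L¹` — finite dilation virial, i.e. finite right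
   slopes. Numerically (arXiv:2106.01715 §§2.2–2.5) `−Δ log ε/Δa` stays locally bounded through the
   entries of 2, 3, 4, 5, 7. Verdict of cycle 1: RESISTS because it is RH-strength (item 2) and the
   only unconditional door (D2) is contradicted by the log-Laplacian edge law.

6. **Numerics (kill criterion k1 of the route)**: kit job `j005351` (`weilflow-v1`, attached to the item on
   completion): Legendre–Ritz `ε_N(a)`, `N ∈ {24,32,48,64(,80,96)}`, tree normalisation checked against the
   digamma form by `mpmath.quadosc`; grid `a ∈ [0.15, 1.2]` refined at the entries `(log n)/2`,
   `n = 2,3,4,5,7,8,9,11`; one-sided difference quotients at the entries for `h ↓ 1e-4`; edge values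
   `√a φ(a)` of the even Ritz ground state vs `N` (edge law test); empirical `K(a) = −Δlog ε/Δa`.
   Verdict rule: right slopes bounded uniformly in `h` and stable in `N` ⇒ consistent with the crux;
   growth `h^{−θ}` persisting as `N` grows ⇒ evidence for door (D2). Published anchors (Connes–Consani,
   arXiv:2106.01715, read p.9 L84–95, p.10 L7): the archimedean-only bottom turns negative just beyond
   `μ = e^{2a} = 2`; with `p = 2` the bottom at `μ = 3` is `< 6·10^{-8}` and positive only for `p` within
   `10^{-3}` of `2`; `log s(L)` is linear in `μ` down to `2.4·10^{-48}` at `μ = 11` — i.e. `K(a) ≍ c e^{2a}`,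
   locally bounded, no spikes reported. Edge law used in item 5: Feulefack–Jarohs–Weth arXiv:2010.10448,
   read p.5: `|φ(x)| = O((−ln dist(x, Ω^c))^{−τ})` for all `τ ∈ (0, 1/2)` for Dirichlet eigenfunctions of
   the logarithmic Laplacian (exterior sphere condition; intervals qualify).

## Cycle 2 findings (gen-2 disprover, 2026-08-16; all sorry-free, same axioms)

7. **Exact unconditional calibration** (`diniLeakage_iff_rh_and_lowerRightLipschitz`): item 1043
   `StrictUnderRH` is now LANDED (`Theorems.strictUnderRH_proof`), so
   `DiniLeakage ↔ RiemannHypothesis ∧ LowerRightLipschitz`, `¬DiniLeakage ↔ (RH → ¬LowerRightLipschitz)`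
   (`not_diniLeakage_iff`), under RH the crux is pure regularity (`diniLeakage_iff_lowerRightLipschitz_of_rh`),
   and modulo the sibling crux 1039 alone it is RH (`diniLeakage_iff_riemannHypothesis_of_windowLipschitz`).
   SHARPER: `LowerRightLipschitz ↔ WindowLipschitz` (`lowerRightLipschitz_iff_windowLipschitz`, the additive
   fence integrates the liminf bound), so **`DiniLeakage ↔ RiemannHypothesis ∧ WindowLipschitz`**
   (`diniLeakage_iff_rh_and_windowLipschitz`, `…_iff_summit_and_windowLipschitz`): item 1038 is EXACTLY the
   conjunction of the summit and item 1039 — the relative rate `K ε(a)` adds nothing. A refuter can only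
   (a) disprove RH or (b) refute `WindowLipschitz` (the sibling disprover's door; = door (D2) of item 5, argued
   shut by the log-Laplacian edge law). A planner may wish to RESTATE 1038 (it is not a crux distinct from
   1039 + the summit) — noted, not ours to do.
8. **Targets = the registered skeleton `Lines/collar_cut_edge_mass.lean`** (stubs B♭ `stub_relEdgeMassLaw`,
   E♭ `stub_relCommutatorBound : B♭ → X`; both ELABORATE, skeleton rc0 with exactly 2 sorries). Section
   "Targets" below: (T1) B♭'s floor is load-bearing and quantitatively `K ε(b₀) + η ≥ log(1/b₀)/b₀`
   (`relEdgeMassLaw_constant_lower_bound`), i.e. `K(b₀) ≳ 1/b₀` by Suzuki's `ε = log(1/a) + O(1)` — SHARPER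
   than the line card's heuristic `1/(b₀ log(1/b₀))`; the floor-free law on `(0,1]` is FALSE
   (`relEdgeMassLaw_false_without_floor`, `not_relEdgeMassLawOn_zero_one`). (T2) at a window with `ε(a) ≤ 0`,
   B♭ forces every ground state to have FLAT edges, `m(r)² = o(r/log(1/r))` (`RelEdgeMassLawOn.flat_of_nonpos`);
   hence B♭ is RH-strength ON ITS OWN modulo a Hopf-type edge lemma `HopfEdge`
   (`riemannHypothesis_of_relEdgeMassLaw_of_hopfEdge` — no E♭, no cut), while `RH ∧ AbsEdgeMassLaw ⇒ B♭`
   (`relEdgeMassLawOn_of_rh_of_abs`) and `B♭ ⇒ AbsEdgeMassLaw` (`absEdgeMassLawOn_of_rel`): up to Hopf,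
   B♭ ≡ RH ∧ (sibling line's unconditional Stub B). (T3) the conclusion `X` of E♭ ALONE gives the crux and RH
   (`diniLeakage_of_relCommutatorConclusion`, `riemannHypothesis_of_relCommutatorConclusion`, through the
   LANDED cut `stub_localizedCut` + the skeleton's glue re-proved here): E♭ is a transfer between two
   RH-strength statements, vacuously true under `¬B♭`. (T4) `X`'s width bound must satisfy `h₀ < b₀`
   (`relCommutatorConclusion_h0_lt_floor`, zero cutoff at `h = b₀`). NO STUB IS REFUTED; the only
   unconditional kill available on this line would be `¬HopfEdge`-free: a window with `ε ≤ 0` (= `¬RH`).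
9. **Second line `Lines/spectral_virial_shadow.lean`** (stubs S/F/P/T, not registered on the item): S is the
   RH-strength bet (finite zero sums at near-minimisers); F (Besov `B^{1/2}_{2,∞}` floor of ground states),
   P (near-minimisers are `H^{log}`-close to a ground state: isolated finite-multiplicity bottom, test
   functions are a form core by construction of the Friedrichs extension) and T (tails via sampling at
   ordinates) were checked on paper for vacuity / junk / quantifier order and look sound; no cheap attack.
10. **Toy model: the prime-free analogue of the crux is FALSE** (numerics of crux-ideate ideator 2, kit
   j006155/j006705, evidence on the item): for the archimedean-only form the EVEN bottom plateaus at `1.06e-3`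
   and crosses `0` at `μ = e^{2a} = 2.271` (= Connes–Consani), the ODD bottom crosses first, TRANSVERSALLY, at
   `a* = 0.3716` (slope `−2.8`, edge value `0.50`), and `−ε′ ≈ 12·edge²` on both branches (Hadamard). By the
   fence `mul_exp_le_of_diniBoundAt` a transversal zero is incompatible with the Dini shape, so
   `DiniShape ε_arch` fails on every range containing `a*`, and B♭_arch fails AT `a*` (`ε_arch = 0`, `T ≠ 0`) —
   exactly the (T2) mechanism. Moral for provers: from `a ≥ 0.37` on, any proof of the crux / of B♭ must use
   the prime sum `Σ_{n<e^{2a}} Λ(n)n^{-1/2}(…)` NON-perturbatively (the prime 2 alone must lift a negative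
   archimedean bottom); an even/odd level crossing of the true `ε` (if any) is a CONCAVE kink — harmless for
   the LOWER right Dini bound.

Gate note: refuters may land only `¬`-theorems / negative lemmas under `Theorems/…/Negative/`; the def-free
negatives of the Targets section are proposed as `Theorems/DiniLeakage/Negative/RelEdgeMassLawFloors.lean`
(`--supports stmt-RiemannHypothesis-1038`); the positive calibrations (items 2, 7, T3) stay here / in the
attached `NegativeCalibration.lean` for a PROVER to land.
-/

noncomputable section

set_option linter.dupNamespace false

open Set Filter Topology MeasureTheory
open scoped NNReal

namespace Summit.RiemannHypothesis.RiemannHypothesis.Cruxes.DiniLeakage.Disproof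

open _root_.Literature.NumberTheory.LFunctions
open _root_.Summit.RiemannHypothesis.RiemannHypothesis.Theses

/-- The window bottom `ε(a)`. -/
local notation "ε" => _root_.Literature.NumberTheory.LFunctions.weilGroundEnergy

/-! ## The Dini shape, abstractly -/

/-- The pointwise clause of the crux for a general `f`: "for arbitrarily small `h > 0`,
`f a − f (a + h) ≤ h (r + η)`", i.e. `liminf_{h→0⁺} (f a − f (a+h))/h ≤ r`. -/
def DiniBoundAt (f : ℝ → ℝ) (a r : ℝ) : Prop :=
  ∀ η δ : ℝ, 0 < η → 0 < δ → ∃ h : ℝ, 0 < h ∧ h < δ ∧ f a - f (a + h) ≤ h * (r + η)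

/-- The crux's shape for a general `f` in place of `ε` (relative rate `K · f a`). -/
def DiniShape (f : ℝ → ℝ) : Prop :=
  ∀ b₀ A : ℝ, 0 < b₀ → b₀ ≤ A → ∃ K : ℝ, ∀ a : ℝ, b₀ ≤ a → a ≤ A → DiniBoundAt f a (K * f a)

/-- The crux IS the Dini shape of `ε` (definitional). -/
theorem diniLeakage_iff_diniShape : WeilWindowFlow.DiniLeakage ↔ DiniShape ε := Iff.rfl

theorem DiniBoundAt.mono {f : ℝ → ℝ} {a r r' : ℝ} (h : DiniBoundAt f a r) (hrr' : r ≤ r') :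
    DiniBoundAt f a r' := by
  intro η δ hη hδ
  obtain ⟨h₁, h₁pos, h₁lt, hle⟩ := h η δ hη hδ
  exact ⟨h₁, h₁pos, h₁lt, hle.trans (by nlinarith)⟩

/-- Filter form: the lower right Dini derivative of `−f` at `a` is `≤ r`, in Mathlib's
`∃ᶠ z in 𝓝[>] a, slope … < r'` idiom. -/
theorem DiniBoundAt.frequently_slope_lt {f : ℝ → ℝ} {a r : ℝ} (h : DiniBoundAt f a r) {r' : ℝ}
    (hr : r < r') : ∃ᶠ z in 𝓝[>] a, slope (fun x ↦ -f x) a z < r' := by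
  rw [Filter.frequently_iff]
  intro U hU
  obtain ⟨u, hu, hsub⟩ := mem_nhdsGT_iff_exists_Ioo_subset.1 hU
  have hδ : 0 < u - a := sub_pos.2 hu
  obtain ⟨h₁, h₁pos, h₁lt, hle⟩ := h ((r' - r) / 2) (u - a) (by linarith) hδ
  refine ⟨a + h₁, hsub ⟨by linarith, by linarith⟩, ?_⟩
  rw [slope_def_field]
  have hh : (a + h₁ - a) = h₁ := by ring
  rw [hh, div_lt_iff₀ h₁pos]
  nlinarith

/-- The crux's `η/δ/h` clause IS Mathlib's liminf-slope idiom (both directions). -/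
theorem diniBoundAt_iff_frequently {f : ℝ → ℝ} {a r : ℝ} :
    DiniBoundAt f a r ↔ ∀ r' : ℝ, r < r' → ∃ᶠ z in 𝓝[>] a, slope (fun x ↦ -f x) a z < r' := by
  refine ⟨fun h r' hr ↦ h.frequently_slope_lt hr, fun h η δ hη hδ ↦ ?_⟩
  have hfr := h (r + η) (by linarith)
  obtain ⟨z, hzs, hzm⟩ := (hfr.and_eventually (Ioo_mem_nhdsGT (show a < a + δ by linarith))).exists
  refine ⟨z - a, by linarith [hzm.1], by linarith [hzm.2], ?_⟩
  rw [slope_def_field, div_lt_iff₀ (by linarith [hzm.1])] at hzs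
  have hz : a + (z - a) = z := by ring
  rw [hz]
  linarith

theorem diniLeakage_iff_frequently :
    WeilWindowFlow.DiniLeakage ↔ ∀ b₀ A : ℝ, 0 < b₀ → b₀ ≤ A → ∃ K : ℝ, ∀ a : ℝ, b₀ ≤ a → a ≤ A →
      ∀ r : ℝ, K * ε a < r → ∃ᶠ z in 𝓝[>] a, slope (fun x ↦ -ε x) a z < r := by
  simp only [diniLeakage_iff_diniShape, DiniShape, diniBoundAt_iff_frequently]

/-- **Additive fence.** Continuous `f` on `[b, c]` with `DiniBoundAt f x L` at every `x ∈ [b, c)`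
loses at most `L (c − b)`: `f b − f c ≤ L (c − b)`. -/
theorem sub_le_of_diniBoundAt {f : ℝ → ℝ} {b c L : ℝ} (hbc : b ≤ c)
    (hf : ContinuousOn f (Icc b c)) (hD : ∀ x ∈ Ico b c, DiniBoundAt f x L) :
    f b - f c ≤ L * (c - b) := by
  have key := image_le_of_liminf_slope_right_le_deriv_boundary (f := fun x ↦ -f x)
    (a := b) (b := c) hf.neg (B := fun x ↦ -f b + L * (x - b)) (B' := fun _ ↦ L)
    (by simp) (by fun_prop)
    (fun x _ ↦ by
      have h1 : HasDerivAt (fun x ↦ -f b + L * (x - b)) L x := by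
        simpa using (((hasDerivAt_id x).sub_const b).const_mul L).const_add (-f b)
      exact h1.hasDerivWithinAt)
    (fun x hx r hr ↦ (hD x hx).frequently_slope_lt hr) (right_mem_Icc.2 hbc)
  linarith

/-- **Multiplicative (Grönwall) fence.** Continuous `f` on `[b, c]`, `f b > 0`, and the RELATIVE
bound `DiniBoundAt f x (K · f x)` at every `x ∈ [b, c)` give `f x ≥ f b · e^{−K (x − b)}` on
`[b, c]` — in particular `f` stays positive: no conjugate point can be reached at a finite
relative rate. (This is the real-analysis core of the route's `DiniGlue`.) -/
theorem mul_exp_le_of_diniBoundAt {f : ℝ → ℝ} {b c K : ℝ} (hf : ContinuousOn f (Icc b c))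
    (hb : 0 < f b) (hD : ∀ x ∈ Ico b c, DiniBoundAt f x (K * f x)) :
    ∀ x ∈ Icc b c, f b * Real.exp (-(K * (x - b))) ≤ f x := by
  intro x hx
  -- for every `e > 0` the barrier with rate `K + e` is not crossed
  have main : ∀ e : ℝ, 0 < e → f b * Real.exp (-(K + e) * (x - b)) ≤ f x := by
    intro e he
    have key := image_le_of_liminf_slope_right_lt_deriv_boundary (f := fun x ↦ -f x)
      (f' := fun x ↦ K * f x) (a := b) (b := c) hf.neg
      (fun x hx r hr ↦ (hD x hx).frequently_slope_lt hr)
      (B := fun x ↦ -f b * Real.exp (-(K + e) * (x - b)))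
      (B' := fun x ↦ (K + e) * (f b * Real.exp (-(K + e) * (x - b))))
      (by simp)
      (fun x ↦ by
        have h1 : HasDerivAt (fun y : ℝ ↦ -(K + e) * (y - b)) (-(K + e) * 1) x :=
          ((hasDerivAt_id' x).sub_const b).const_mul (-(K + e))
        have h2 := (h1.exp).const_mul (-f b)
        simp only [mul_one] at h2
        exact h2.congr_deriv (by ring))
      (fun x _ hxB ↦ by
        -- at a touching point `f x = f b e^{…} > 0`, and `(K+e) f x > K f x`
        have hfx : f x = f b * Real.exp (-(K + e) * (x - b)) := by linarith
        have hpos : 0 < f x := by rw [hfx]; positivity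
        rw [← hfx]
        nlinarith)
      hx
    linarith
  -- let `e → 0⁺` (closedness of the sublevel set in `e`)
  have hcl : IsClosed {e : ℝ | f b * Real.exp (-(K + e) * (x - b)) ≤ f x} :=
    isClosed_le (by fun_prop) continuous_const
  have hmem : (0 : ℝ) ∈ closure (Ioi (0 : ℝ)) := by simp [closure_Ioi]
  have h0 : f b * Real.exp (-(K + 0) * (x - b)) ≤ f x :=
    (hcl.closure_subset_iff.2 (fun e he ↦ main e he)) hmem
  simpa [neg_mul] using h0

/-! ## The abstract shape forces neither sign nor continuity (glue hypotheses are load-bearing) -/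

/-- The antitone step with a jump approached from the LEFT: `1` on `(−∞, 1)`, `−1` on `[1, ∞)`. -/
def stepWitness : ℝ → ℝ := fun x ↦ if x < 1 then 1 else -1

theorem antitone_stepWitness : Antitone stepWitness := by
  intro x y hxy
  unfold stepWitness
  split_ifs <;> linarith

/-- The step satisfies the crux's shape with `K = 0` on every range: right difference quotients
vanish for small `h` at every point (the jump at `1` is invisible from the right of points `a < 1`
once `h < 1 − a`, and `f` is constant on `[1, ∞)`). -/
theorem diniShape_stepWitness : DiniShape stepWitness := by
  intro b₀ A _ _
  refine ⟨0, fun a _ _ η δ hη hδ ↦ ?_⟩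
  by_cases ha : a < 1
  · refine ⟨min (δ / 2) ((1 - a) / 2), lt_min (by linarith) (by linarith),
      lt_of_le_of_lt (min_le_left _ _) (by linarith), ?_⟩
    have h1 : a + min (δ / 2) ((1 - a) / 2) < 1 := by
      have := min_le_right (δ / 2) ((1 - a) / 2); linarith
    have hpos : 0 < min (δ / 2) ((1 - a) / 2) := lt_min (by linarith) (by linarith)
    simp only [stepWitness, if_pos ha, if_pos h1, sub_self]
    positivity
  · refine ⟨δ / 2, by linarith, by linarith, ?_⟩
    have h1 : ¬ a + δ / 2 < 1 := by linarith
    simp only [stepWitness, if_neg ha, if_neg h1, sub_self]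
    positivity

/-- Hence: antitone + Dini shape + positivity at one window do NOT give positivity at all windows
(the abstract `DiniGlue` needs continuity; for `ε` continuity is a tree theorem). -/
theorem not_diniShape_forces_pos :
    ¬ ∀ f : ℝ → ℝ, Antitone f → DiniShape f → 0 < f (1 / 2) → ∀ a : ℝ, 0 < a → 0 < f a := by
  intro h
  have := h stepWitness antitone_stepWitness diniShape_stepWitness
    (by norm_num [stepWitness]) 1 one_pos
  norm_num [stepWitness] at this

/-! ## Continuity of `ε` on compact ranges (tree: Suzuki 2026 Thm 1.3, proved) -/

theorem continuousOn_eps {b c : ℝ} (hb : 0 < b) : ContinuousOn ε (Icc b c) :=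
  fun _ hx ↦ (continuousAt_weilGroundEnergy (lt_of_lt_of_le hb hx.1)).continuousWithinAt

/-- `ε` is antitone on `(0, ∞)` (larger window, smaller infimum; the spheres are nonempty and bounded
below: `exists_isWeilTest_sphere`, `bddBelow_weilQuadratic_sphere_holds`). Not yet a tree lemma. -/
theorem eps_antitoneOn : AntitoneOn ε (Ioi 0) := by
  intro b hb a _ hba
  obtain ⟨g, hg, hs, hn⟩ := exists_isWeilTest_sphere (a := b) hb
  refine csInf_le_csInf (bddBelow_weilQuadratic_sphere_holds a) ⟨_, g, hg, hs, hn, rfl⟩ ?_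
  rintro x ⟨g', hg', hs', hn', rfl⟩
  exact ⟨g', hg', hs'.trans (Icc_subset_Icc (neg_le_neg hba) hba), hn', rfl⟩

/-- Hence all difference quotients in the crux are `≥ 0`, and any admissible `K` may be replaced by
`max K 0` wherever `ε ≥ 0`: the sign freedom of `K` in the signature is immaterial under RH. -/
theorem eps_sub_nonneg {a h : ℝ} (ha : 0 < a) (hh : 0 ≤ h) : 0 ≤ ε a - ε (a + h) :=
  sub_nonneg.2 (eps_antitoneOn ha (show (0 : ℝ) < a + h by simpa using add_pos_of_pos_of_nonneg ha hh)
    (le_add_of_nonneg_right hh))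

/-! ## Calibration I: the crux alone forces positivity of every window bottom, hence RH -/

/-- `DiniLeakage ⟹ ε(a) > 0` for every `a > 0`: Grönwall fence from the proved coercive anchor
`exists_weilGroundEnergy_pos` (Bombieri 2000 Thm 12) — a first conjugate point cannot be reached
at a finite relative rate. -/
theorem pos_of_diniLeakage (hD : WeilWindowFlow.DiniLeakage) : ∀ a : ℝ, 0 < a → 0 < ε a := by
  obtain ⟨a₁, ha₁, hpos⟩ := exists_weilGroundEnergy_pos
  intro a ha
  by_cases hle : a ≤ a₁
  · exact hpos a ha hle
  · have hlt : a₁ ≤ a := (lt_of_not_ge hle).le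
    obtain ⟨K, hK⟩ := hD a₁ a ha₁ hlt
    have h := mul_exp_le_of_diniBoundAt (continuousOn_eps ha₁) (hpos a₁ ha₁ le_rfl)
      (fun x hx ↦ hK x hx.1 hx.2.le) a ⟨hlt, le_rfl⟩
    exact lt_of_lt_of_le (by have := hpos a₁ ha₁ le_rfl; positivity) h

/-- **The crux decides RH by itself**: `DiniLeakage → RiemannHypothesis` (positivity of every
window bottom is Weil positivity on every window, `weilGroundEnergy_nonneg_iff_holds`, and Yoshida's
criterion `riemannHypothesis_iff_forall_weilPositivityOn`). No `WindowContinuity`/`DiniGlue`/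
`GronwallLeakage` item is needed: the crux is at least summit-strength. -/
theorem riemannHypothesis_of_diniLeakage (hD : WeilWindowFlow.DiniLeakage) : RiemannHypothesis :=
  riemannHypothesis_iff_forall_weilPositivityOn.2 fun a ha ↦
    (weilGroundEnergy_nonneg_iff_holds ha).1 (pos_of_diniLeakage hD a ha).le

theorem summit_of_diniLeakage (hD : WeilWindowFlow.DiniLeakage) : _root_.Summit.RiemannHypothesis :=
  _root_.Summit.RiemannHypothesis_iff.2 (riemannHypothesis_of_diniLeakage hD)

/-! ## Calibration II: exact decomposition `DiniLeakage ↔ positivity ∧ lower-right local Lipschitz` -/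

/-- The unconditional half of the crux: a locally uniform bound on the LOWER right difference
quotients of `ε` (the crux's shape with an absolute rate). Implied by the route's `WindowLipschitz`
(`lowerRightLipschitz_of_windowLipschitz`), strictly weaker in form (liminf, one-sided). -/
def LowerRightLipschitz : Prop :=
  ∀ b₀ A : ℝ, 0 < b₀ → b₀ ≤ A → ∃ L : ℝ, ∀ a : ℝ, b₀ ≤ a → a ≤ A → DiniBoundAt ε a L

theorem lowerRightLipschitz_of_windowLipschitz (hW : WeilWindowFlow.WindowLipschitz) :
    LowerRightLipschitz := by
  intro b₀ A hb₀ hA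
  obtain ⟨L, hL⟩ := hW b₀ (A + 1) hb₀ (by linarith)
  refine ⟨L, fun a ha haA η δ hη hδ ↦ ⟨min δ 1 / 2, by positivity,
    by have := min_le_left δ 1; linarith, ?_⟩⟩
  have h1 : min δ 1 / 2 ≤ 1 / 2 := by have := min_le_right δ 1; linarith
  have hpos : 0 < min δ 1 / 2 := by positivity
  have := hL a (a + min δ 1 / 2) ha (by linarith) (by linarith)
  nlinarith

theorem lowerRightLipschitz_of_diniLeakage (hD : WeilWindowFlow.DiniLeakage) :
    LowerRightLipschitz := by
  intro b₀ A hb₀ hA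
  obtain ⟨K, hK⟩ := hD b₀ A hb₀ hA
  obtain ⟨C, hC⟩ := (isCompact_Icc (a := b₀) (b := A)).exists_bound_of_continuousOn
    (continuousOn_eps hb₀)
  refine ⟨|K| * C, fun a ha haA ↦ DiniBoundAt.mono (f := ε) (a := a) (r := K * ε a) (hK a ha haA) ?_⟩
  have h1 : |ε a| ≤ C := by simpa [Real.norm_eq_abs] using hC a ⟨ha, haA⟩
  calc K * ε a ≤ |K * ε a| := le_abs_self _
    _ = |K| * |ε a| := abs_mul _ _
    _ ≤ |K| * C := by gcongr

theorem diniLeakage_of_pos_of_lowerRightLipschitz (hpos : ∀ a : ℝ, 0 < a → 0 < ε a)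
    (hL : LowerRightLipschitz) : WeilWindowFlow.DiniLeakage := by
  intro b₀ A hb₀ hA
  obtain ⟨L, hL⟩ := hL b₀ A hb₀ hA
  obtain ⟨a₀, ha₀, hmin⟩ := (isCompact_Icc (a := b₀) (b := A)).exists_isMinOn
    (nonempty_Icc.2 hA) (continuousOn_eps hb₀)
  have hm : 0 < ε a₀ := hpos a₀ (lt_of_lt_of_le hb₀ ha₀.1)
  refine ⟨max L 0 / ε a₀, fun a ha haA ↦ (hL a ha haA).mono ?_⟩
  have h1 : ε a₀ ≤ ε a := hmin ⟨ha, haA⟩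
  have h2 : 0 ≤ max L 0 / ε a₀ := by positivity
  calc L ≤ max L 0 := le_max_left _ _
    _ = max L 0 / ε a₀ * ε a₀ := by field_simp
    _ ≤ max L 0 / ε a₀ * ε a := by gcongr

/-- **Exact decomposition of the crux.** -/
theorem diniLeakage_iff_pos_and_lowerRightLipschitz :
    WeilWindowFlow.DiniLeakage ↔ (∀ a : ℝ, 0 < a → 0 < ε a) ∧ LowerRightLipschitz :=
  ⟨fun h ↦ ⟨pos_of_diniLeakage h, lowerRightLipschitz_of_diniLeakage h⟩,
    fun h ↦ diniLeakage_of_pos_of_lowerRightLipschitz h.1 h.2⟩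

/-- Modulo the two OTHER route items `StrictUnderRH` (1043) and `WindowLipschitz` (1039), the crux
is literally the Riemann hypothesis. -/
theorem diniLeakage_iff_riemannHypothesis (h₁₀₄₃ : WeilWindowFlow.StrictUnderRH)
    (h₁₀₃₉ : WeilWindowFlow.WindowLipschitz) :
    WeilWindowFlow.DiniLeakage ↔ RiemannHypothesis :=
  ⟨riemannHypothesis_of_diniLeakage, fun hRH ↦
    diniLeakage_of_pos_of_lowerRightLipschitz (h₁₀₄₃ (_root_.Summit.RiemannHypothesis_iff.2 hRH))
      (lowerRightLipschitz_of_windowLipschitz h₁₀₃₉)⟩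

/-! ## Hypothesis mutation: the slack `η` is decorative -/

/-- The crux with the slack `η` removed (`0 < η` dropped, `η := 0`). -/
def DiniLeakageEta0 : Prop :=
  ∀ b₀ A : ℝ, 0 < b₀ → b₀ ≤ A → ∃ K : ℝ, ∀ a : ℝ, b₀ ≤ a → a ≤ A → ∀ δ : ℝ, 0 < δ →
    ∃ h : ℝ, 0 < h ∧ h < δ ∧ ε a - ε (a + h) ≤ h * (K * ε a)

/-- **`η` is unnecessary**: the `η`-free form is EQUIVALENT to the crux (through the decomposition:
positivity gives room to absorb `η = 1` into a larger `K`). Provers may target either form. -/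
theorem diniLeakage_iff_eta0 : WeilWindowFlow.DiniLeakage ↔ DiniLeakageEta0 := by
  constructor
  · intro hD b₀ A hb₀ hA
    have hpos := pos_of_diniLeakage hD
    obtain ⟨L, hL⟩ := lowerRightLipschitz_of_diniLeakage hD b₀ A hb₀ hA
    obtain ⟨a₀, ha₀, hmin⟩ := (isCompact_Icc (a := b₀) (b := A)).exists_isMinOn
      (nonempty_Icc.2 hA) (continuousOn_eps hb₀)
    have hm : 0 < ε a₀ := hpos a₀ (lt_of_lt_of_le hb₀ ha₀.1)
    refine ⟨(max L 0 + 1) / ε a₀, fun a ha haA δ hδ ↦ ?_⟩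
    obtain ⟨h, hh, hhδ, hle⟩ := hL a ha haA 1 δ one_pos hδ
    refine ⟨h, hh, hhδ, hle.trans ?_⟩
    have h1 : ε a₀ ≤ ε a := hmin ⟨ha, haA⟩
    have h2 : 0 ≤ (max L 0 + 1) / ε a₀ := by positivity
    have h3 : L + 1 ≤ (max L 0 + 1) / ε a₀ * ε a :=
      calc L + 1 ≤ max L 0 + 1 := by gcongr; exact le_max_left _ _
        _ = (max L 0 + 1) / ε a₀ * ε a₀ := by field_simp
        _ ≤ (max L 0 + 1) / ε a₀ * ε a := by gcongr
    nlinarith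
  · intro hE b₀ A hb₀ hA
    obtain ⟨K, hK⟩ := hE b₀ A hb₀ hA
    refine ⟨K, fun a ha haA η δ hη hδ ↦ ?_⟩
    obtain ⟨h, hh, hhδ, hle⟩ := hK a ha haA δ hδ
    exact ⟨h, hh, hhδ, hle.trans (by nlinarith)⟩

/-! ## Load-bearing hypothesis: the range must stay away from `0` -/

/-- The crux with the hypothesis `0 < b₀` dropped (ranges `(0, A]`, one `K` down to `a → 0⁺`). -/
def DiniLeakageWithoutB0Pos : Prop :=
  ∀ A : ℝ, 0 < A → ∃ K : ℝ, ∀ a : ℝ, 0 < a → a ≤ A → DiniBoundAt ε a (K * ε a)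

/-- The crux with the quantifiers `∀ b₀ A … ∃ K` strengthened to `∃ K ∀ a > 0`. -/
def DiniLeakageUniformK : Prop :=
  ∃ K : ℝ, ∀ a : ℝ, 0 < a → DiniBoundAt ε a (K * ε a)

/-- **`0 < b₀` is load-bearing**: with ranges reaching `0` the statement is FALSE. A rate `K`
valid on `(0, a₁]` fences `ε(b) ≤ ε(a₁) e^{|K| a₁}` for all `b ∈ (0, a₁]`, whereas
`ε(b) → +∞` as `b → 0⁺` (coercivity, `weilQuadratic_coercive`, Bombieri 2000 Thm 12). -/
theorem diniLeakage_false_without_b0_pos : ¬ DiniLeakageWithoutB0Pos := by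
  intro h
  obtain ⟨a₁, ha₁, hpos⟩ := exists_weilGroundEnergy_pos
  obtain ⟨K, hK⟩ := h a₁ ha₁
  set M : ℝ := ε a₁ * Real.exp (|K| * a₁) with hM
  -- fence: every `b ∈ (0, a₁]` has `ε b ≤ M`
  have hbound : ∀ b : ℝ, 0 < b → b ≤ a₁ → ε b ≤ M := by
    intro b hb hba
    have h := mul_exp_le_of_diniBoundAt (b := b) (c := a₁) (K := K) (continuousOn_eps hb)
      (hpos b hb hba) (fun x hx ↦ hK x (lt_of_lt_of_le hb hx.1) hx.2.le) a₁ ⟨hba, le_rfl⟩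
    have h1 : Real.exp (-(K * (a₁ - b))) * Real.exp (|K| * a₁) ≥ 1 := by
      rw [← Real.exp_add]
      apply Real.one_le_exp
      have : K * (a₁ - b) ≤ |K| * a₁ := by
        calc K * (a₁ - b) ≤ |K * (a₁ - b)| := le_abs_self _
          _ = |K| * |a₁ - b| := abs_mul _ _
          _ ≤ |K| * a₁ := by
              gcongr
              rw [abs_of_nonneg (by linarith)]; linarith
      linarith
    have h2 : 0 < ε b := hpos b hb hba
    have h3 : 0 ≤ Real.exp (|K| * a₁) := (Real.exp_pos _).le
    calc ε b = ε b * 1 := by ring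
      _ ≤ ε b * (Real.exp (-(K * (a₁ - b))) * Real.exp (|K| * a₁)) := by gcongr
      _ = (ε b * Real.exp (-(K * (a₁ - b)))) * Real.exp (|K| * a₁) := by ring
      _ ≤ ε a₁ * Real.exp (|K| * a₁) := by gcongr
  -- coercivity: `ε(b) ≥ M + 1` for `b` small
  obtain ⟨a₂, ha₂, hco⟩ := weilQuadratic_coercive (M + 1)
  have hb : 0 < min a₁ a₂ := lt_min ha₁ ha₂
  have hge : M + 1 ≤ ε (min a₁ a₂) :=
    le_weilGroundEnergy_of_forall hb fun g hg hs hn ↦ by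
      have := hco (min a₁ a₂) hb (min_le_right _ _) g hg hs
      rwa [hn, mul_one] at this
  have hle := hbound (min a₁ a₂) hb (min_le_left _ _)
  linarith

theorem not_diniLeakageUniformK : ¬ DiniLeakageUniformK := fun ⟨K, hK⟩ ↦
  diniLeakage_false_without_b0_pos fun _ _ ↦ ⟨K, fun a ha _ ↦ hK a ha⟩

/-- For contrast, the crux itself is of course implied by the uniform version restricted to
`[b₀, ∞)`-ranges; what item 3 kills is only uniformity at `0⁺`. The absolute analogue: no single
`L` bounds the lower right slopes on `(0, A]` either. -/
theorem not_lowerRightLipschitz_without_b0_pos :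
    ¬ ∀ A : ℝ, 0 < A → ∃ L : ℝ, ∀ a : ℝ, 0 < a → a ≤ A → DiniBoundAt ε a L := by
  intro h
  obtain ⟨a₁, ha₁, hpos⟩ := exists_weilGroundEnergy_pos
  obtain ⟨L, hL⟩ := h a₁ ha₁
  obtain ⟨a₂, ha₂, hco⟩ := weilQuadratic_coercive (ε a₁ + |L| * a₁ + 1)
  have hb : 0 < min a₁ a₂ := lt_min ha₁ ha₂
  have hge : ε a₁ + |L| * a₁ + 1 ≤ ε (min a₁ a₂) :=
    le_weilGroundEnergy_of_forall hb fun g hg hs hn ↦ by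
      have := hco (min a₁ a₂) hb (min_le_right _ _) g hg hs
      rwa [hn, mul_one] at this
  have hfence := sub_le_of_diniBoundAt (min_le_left a₁ a₂) (continuousOn_eps hb)
    (fun x hx ↦ hL x (lt_of_lt_of_le hb hx.1) hx.2.le)
  have h1 : L * (a₁ - min a₁ a₂) ≤ |L| * a₁ := by
    calc L * (a₁ - min a₁ a₂) ≤ |L * (a₁ - min a₁ a₂)| := le_abs_self _
      _ = |L| * |a₁ - min a₁ a₂| := abs_mul _ _
      _ ≤ |L| * a₁ := by
          gcongr
          rw [abs_of_nonneg (sub_nonneg.2 (min_le_left _ _))]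
          linarith [hb.le]
  linarith


/-! ## Calibration III (cycle 2): `StrictUnderRH` is now PROVED — the crux is exactly `RH ∧ LowerRightLipschitz` -/

/-- **Exact unconditional calibration.** With item 1043 landed (`Theorems.strictUnderRH_proof`: under RH
every window bottom is strictly positive — ground state + explicit formula + Jensen), the crux is EQUIVALENT
to the conjunction of the Riemann hypothesis and the lower-right local Lipschitz property of `ε`.
Door (D1) of cycle 1 is now literally `¬RH`; door (D2) is `¬LowerRightLipschitz`. -/
theorem diniLeakage_iff_rh_and_lowerRightLipschitz :
    WeilWindowFlow.DiniLeakage ↔ RiemannHypothesis ∧ LowerRightLipschitz := by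
  refine ⟨fun h ↦ ⟨riemannHypothesis_of_diniLeakage h, lowerRightLipschitz_of_diniLeakage h⟩,
    fun h ↦ diniLeakage_of_pos_of_lowerRightLipschitz ?_ h.2⟩
  exact _root_.Summit.RiemannHypothesis.RiemannHypothesis.Theorems.strictUnderRH_proof
    (_root_.Summit.RiemannHypothesis_iff.2 h.1)

/-- Hence, modulo the sibling crux `WindowLipschitz` (item 1039) ALONE, the crux is the Riemann hypothesis. -/
theorem diniLeakage_iff_riemannHypothesis_of_windowLipschitz (h₁₀₃₉ : WeilWindowFlow.WindowLipschitz) :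
    WeilWindowFlow.DiniLeakage ↔ RiemannHypothesis :=
  diniLeakage_iff_riemannHypothesis
    _root_.Summit.RiemannHypothesis.RiemannHypothesis.Theorems.strictUnderRH_proof h₁₀₃₉

/-- The two doors, formally: a refutation of the crux is exactly a proof of `RH → ¬LowerRightLipschitz`
(so: `¬RH`, or — granting RH — unbounded lower right difference quotients of `ε` on a compact range). -/
theorem not_diniLeakage_iff :
    ¬ WeilWindowFlow.DiniLeakage ↔ (RiemannHypothesis → ¬ LowerRightLipschitz) := by
  rw [diniLeakage_iff_rh_and_lowerRightLipschitz, not_and]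

/-- **`LowerRightLipschitz` IS the sibling crux `WindowLipschitz` (item 1039).** The liminf/one-sided form
is not weaker: the additive fence `sub_le_of_diniBoundAt` (continuity of `ε` PROVED) integrates the lower right
Dini bound to `ε b − ε a ≤ L (a − b)` on `[b₀, A]`, which is `WindowLipschitz` verbatim. -/
theorem lowerRightLipschitz_iff_windowLipschitz : LowerRightLipschitz ↔ WeilWindowFlow.WindowLipschitz := by
  refine ⟨fun hL b₀ A hb₀ hA ↦ ?_, lowerRightLipschitz_of_windowLipschitz⟩
  obtain ⟨L, hL⟩ := hL b₀ A hb₀ hA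
  refine ⟨L, fun b a hb hba haA ↦ ?_⟩
  exact sub_le_of_diniBoundAt hba (continuousOn_eps (lt_of_lt_of_le hb₀ hb))
    (fun x hx ↦ hL x (hb.trans hx.1) (hx.2.le.trans haA))

/-- **THE CRUX IS EXACTLY `RH ∧ WindowLipschitz`** (summit ∧ sibling crux 1039), unconditionally:
`DiniLeakage ↔ RiemannHypothesis ∧ WindowLipschitz`. Consequences for the crux chain: every line proving
item 1038 contains a proof of item 1039 AND of RH; the relative rate `K ε(a)` carries no information beyond
this conjunction; a disproof is `¬RH` or `¬WindowLipschitz` (the sibling disprover's door). -/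
theorem diniLeakage_iff_rh_and_windowLipschitz :
    WeilWindowFlow.DiniLeakage ↔ RiemannHypothesis ∧ WeilWindowFlow.WindowLipschitz := by
  rw [diniLeakage_iff_rh_and_lowerRightLipschitz, lowerRightLipschitz_iff_windowLipschitz]

/-- Summit-level form: `DiniLeakage ↔ Summit.RiemannHypothesis ∧ WindowLipschitz`. -/
theorem diniLeakage_iff_summit_and_windowLipschitz :
    WeilWindowFlow.DiniLeakage ↔ _root_.Summit.RiemannHypothesis ∧ WeilWindowFlow.WindowLipschitz := by
  rw [diniLeakage_iff_rh_and_windowLipschitz, _root_.Summit.RiemannHypothesis_iff]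

/-- Under RH the crux is PURE REGULARITY: it is equivalent to `LowerRightLipschitz` (and implied by
`WindowLipschitz`). Provers working under an RH hypothesis gain nothing from the relative form `K ε a`. -/
theorem diniLeakage_iff_lowerRightLipschitz_of_rh (hRH : RiemannHypothesis) :
    WeilWindowFlow.DiniLeakage ↔ LowerRightLipschitz := by
  rw [diniLeakage_iff_rh_and_lowerRightLipschitz]
  exact ⟨fun h ↦ h.2, fun h ↦ ⟨hRH, h⟩⟩

/-! ## Targets (cycle 2): the registered skeleton `Lines/collar_cut_edge_mass.lean`

Stubs: `stub_relEdgeMassLaw` (B♭, the bet) and `stub_relCommutatorBound` (E♭ : B♭ → X). Findings, all proved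
below: (T1) B♭'s floor `0 < b₀` is load-bearing, quantitatively `K ε(b₀) + η ≥ log(1/b₀)/b₀` whenever
`r₀ ≥ b₀`, and the floor-free version on `(0, 1]` is FALSE (Suzuki's asymptotic `ε(a) = log(1/a) + O(1)` makes
the relative constant useless at small windows: `K ≳ 1/b₀`, sharper than the line card's heuristic
`1/(b₀ log(1/b₀))`); (T2) at a window with `ε(a) ≤ 0` B♭ forces EVERY ground state to have flat edges
(`m(r)² = o(r/log(1/r))`), so B♭ is RH-strength BY ITSELF modulo a Hopf-type edge lemma
(`riemannHypothesis_of_relEdgeMassLaw_of_hopfEdge`), without E♭ and without the cut; conversely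
`RH ∧ (absolute edge-mass law) ⇒ B♭` (`relEdgeMassLawOn_of_rh_of_abs`) and `B♭ ⇒ absolute law`
(`absEdgeMassLawOn_of_rel`): up to Hopf, B♭ ≡ RH ∧ (the sibling line's unconditional Stub B);
(T3) the CONCLUSION X of E♭ alone implies the crux and hence RH (`riemannHypothesis_of_relCommutatorConclusion`,
through the LANDED cut `stub_localizedCut` and the skeleton's glue): E♭ is an implication between two
RH-strength statements — "unconditional" only as a transfer, vacuous under `¬B♭`. No stub is refuted. -/

/-- The statement of Stub B♭ on ONE range `[b₀, A]` (verbatim body of `stub_relEdgeMassLaw`). -/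
def RelEdgeMassLawOn (b₀ A : ℝ) : Prop :=
  ∃ K : ℝ, 0 ≤ K ∧ ∀ η : ℝ, 0 < η → ∃ r₀ : ℝ, 0 < r₀ ∧ r₀ < 1 ∧
    ∀ (a r : ℝ) (u : ℝ → ℂ), b₀ ≤ a → a ≤ A → IsWeilGroundState a u → 0 < r → r ≤ r₀ →
      ∫ x in {x : ℝ | a - r < |x|}, ‖u x‖ ^ 2 ≤ (K * ε a + η) * r / Real.log (1 / r)

/-- Stub B♭ verbatim (`stub_relEdgeMassLaw` of `Lines/collar_cut_edge_mass.lean`). -/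
def RelEdgeMassLaw : Prop := ∀ b₀ A : ℝ, 0 < b₀ → b₀ ≤ A → RelEdgeMassLawOn b₀ A

/-- The ABSOLUTE `L²` edge-mass law on a range (the sibling line `cut-dont-squeeze`'s Stub B shape, cf.
`Theorems/WindowLipschitz/Negative/CutDontSqueezeFloors.lean`). -/
def AbsEdgeMassLawOn (b₀ A : ℝ) : Prop :=
  ∃ K d₀ : ℝ, 0 < d₀ ∧ d₀ < 1 ∧ ∀ (a r : ℝ) (u : ℝ → ℂ), b₀ ≤ a → a ≤ A → IsWeilGroundState a u →
    0 < r → r ≤ d₀ → ∫ x in {x : ℝ | a - r < |x|}, ‖u x‖ ^ 2 ≤ K * r / Real.log (1 / r)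

theorem log_one_div_pos {r : ℝ} (hr : 0 < r) (hr1 : r < 1) : 0 < Real.log (1 / r) :=
  Real.log_pos (by rw [lt_div_iff₀ hr, one_mul]; exact hr1)

/-- **(T1, quantitative) Tightness of B♭'s constant at the floor.** If `(K, η, r₀)` realise B♭ on `[b₀, A]`
and `b₀ ≤ r₀`, then at `a = r = b₀` the edge layer carries the whole mass `1`
(`CutDontSqueezeFloors.edgeMass_eq_one_of_radius_eq_window`), so `log(1/b₀) ≤ (K ε(b₀) + η) b₀`. With
`ε(b₀) = log(1/b₀) + O(1)` (Suzuki 2026 Thm 1.4) this forces `K(b₀, A) ≳ 1/b₀` as `b₀ → 0⁺`. -/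
theorem relEdgeMassLaw_constant_lower_bound {b₀ A K η r₀ : ℝ} (hb₀ : 0 < b₀) (hA : b₀ ≤ A)
    (hr : b₀ ≤ r₀) (hr₀1 : r₀ < 1)
    (hK : ∀ (a r : ℝ) (u : ℝ → ℂ), b₀ ≤ a → a ≤ A → IsWeilGroundState a u → 0 < r → r ≤ r₀ →
      ∫ x in {x : ℝ | a - r < |x|}, ‖u x‖ ^ 2 ≤ (K * ε a + η) * r / Real.log (1 / r)) :
    Real.log (1 / b₀) ≤ (K * ε b₀ + η) * b₀ := by
  obtain ⟨u, hu⟩ := ConnesConsaniMoscovici2025_thm_3_6_holds.exists_isWeilGroundState hb₀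
  have h := hK b₀ b₀ u le_rfl hA hu hb₀ hr
  rw [_root_.Summit.RiemannHypothesis.RiemannHypothesis.Theorems.CutDontSqueezeFloors.edgeMass_eq_one_of_radius_eq_window
    hu] at h
  rwa [le_div_iff₀ (log_one_div_pos hb₀ (lt_of_le_of_lt hr hr₀1)), one_mul] at h

/-- Suzuki's asymptotic, upper half: `ε(a) ≤ log(1/a) + M` on `(0, a₀]` for explicit `M ≥ 0`, `a₀ > 0`
(`Suzuki2026_thm_1_4_asymptotic_holds`, PROVED in the tree). -/
theorem exists_eps_le_log_add :
    ∃ M a₀ : ℝ, 0 ≤ M ∧ 0 < a₀ ∧ ∀ a : ℝ, 0 < a → a ≤ a₀ → ε a ≤ Real.log (1 / a) + M := by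
  obtain ⟨μ₁, _, C, a₀, ha₀, h⟩ := Suzuki2026_thm_1_4_asymptotic_holds
  refine ⟨|μ₁ - Real.log (2 * Real.pi) - Real.eulerMascheroniConstant| + |C| * a₀, a₀, by positivity,
    ha₀, fun a ha haa ↦ ?_⟩
  have h1 := (abs_le.1 (h a ha haa)).2
  have h2 : C * a ≤ |C| * a₀ :=
    (mul_le_mul_of_nonneg_right (le_abs_self C) ha.le).trans (mul_le_mul_of_nonneg_left haa (abs_nonneg C))
  have h3 : μ₁ - Real.log (2 * Real.pi) - Real.eulerMascheroniConstant ≤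
      |μ₁ - Real.log (2 * Real.pi) - Real.eulerMascheroniConstant| := le_abs_self _
  linarith

/-- **(T1) B♭'s floor `0 < b₀` is load-bearing**: the relative edge-mass law on the window range `(0, 1]`
(floor removed, statement inline) is FALSE. At `a = r → 0⁺` the layer carries mass `1` while
`(K ε(a) + 1) a / log(1/a) ≤ K a + 2(KM + 1) a → 0` because `ε(a) ≤ log(1/a) + M` (Suzuki): the RELATIVE
constant does not rescue small windows (contrast: `ε(a) → +∞` there). Any proof of B♭ must use `b₀` —
in the line through the sup bound (A) and `ε(b₀)`. -/
theorem relEdgeMassLaw_false_without_floor :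
    ¬ ∃ K : ℝ, 0 ≤ K ∧ ∀ η : ℝ, 0 < η → ∃ r₀ : ℝ, 0 < r₀ ∧ r₀ < 1 ∧
      ∀ (a r : ℝ) (u : ℝ → ℂ), 0 < a → a ≤ 1 → IsWeilGroundState a u → 0 < r → r ≤ r₀ →
        ∫ x in {x : ℝ | a - r < |x|}, ‖u x‖ ^ 2 ≤ (K * ε a + η) * r / Real.log (1 / r) := by
  rintro ⟨K, hK0, hK⟩
  obtain ⟨r₀, hr₀, hr₀1, h1⟩ := hK 1 one_pos
  obtain ⟨M, a₀, hM0, ha₀, hup⟩ := exists_eps_le_log_add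
  have hD : 0 < K * (1 + 2 * M) + 2 := by positivity
  set a : ℝ := min r₀ (min a₀ (min (1 / 2) (1 / (2 * (K * (1 + 2 * M) + 2))))) with ha_def
  have ha : 0 < a := lt_min hr₀ (lt_min ha₀ (lt_min (by norm_num) (by positivity)))
  have har : a ≤ r₀ := min_le_left _ _
  have haa₀ : a ≤ a₀ := (min_le_right _ _).trans (min_le_left _ _)
  have ha2 : a ≤ 1 / 2 := (min_le_right _ _).trans ((min_le_right _ _).trans (min_le_left _ _))
  have haD : a ≤ 1 / (2 * (K * (1 + 2 * M) + 2)) :=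
    (min_le_right _ _).trans ((min_le_right _ _).trans (min_le_right _ _))
  have ha1 : a ≤ 1 := by linarith
  obtain ⟨u, hu⟩ := ConnesConsaniMoscovici2025_thm_3_6_holds.exists_isWeilGroundState ha
  have h := h1 a a u ha ha1 hu ha har
  rw [_root_.Summit.RiemannHypothesis.RiemannHypothesis.Theorems.CutDontSqueezeFloors.edgeMass_eq_one_of_radius_eq_window
    hu] at h
  set L : ℝ := Real.log (1 / a) with hL_def
  -- `L = log(1/a) ≥ log 2 > 1/2`
  have hL : 1 / 2 < L := by
    have h2 : (2 : ℝ) ≤ 1 / a := by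
      rw [le_div_iff₀ ha]
      linarith
    have hlog2 : (1 : ℝ) / 2 < Real.log 2 := by
      have := Real.log_two_gt_d9
      linarith
    exact lt_of_lt_of_le hlog2 (Real.log_le_log (by norm_num) h2)
  have hL0 : 0 < L := by linarith
  rw [le_div_iff₀ hL0, one_mul] at h
  -- `h : L ≤ (K ε a + 1) a`; but `(K ε a + 1) a ≤ (K a) L + (K M + 1) a ≤ L/2 + 1/4 < L`
  have hεa : ε a ≤ L + M := hup a ha haa₀
  have hKε : K * ε a ≤ K * (L + M) := mul_le_mul_of_nonneg_left hεa hK0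
  have hstep : (K * ε a + 1) * a ≤ (K * a) * L + (K * M + 1) * a := by nlinarith
  have haD' : a * (2 * (K * (1 + 2 * M) + 2)) ≤ 1 := by
    rwa [le_div_iff₀ (by positivity)] at haD
  have hKa : K * a ≤ 1 / 2 := by nlinarith [mul_nonneg (mul_nonneg hK0 hM0) ha.le]
  have hKMa : (K * M + 1) * a ≤ 1 / 4 := by nlinarith [mul_nonneg hK0 ha.le]
  have hKaL : (K * a) * L ≤ (1 / 2) * L := mul_le_mul_of_nonneg_right hKa hL0.le
  linarith

/-- B♭'s statement in the floor-free form above is implied by `RelEdgeMassLaw` restricted to `b₀ = 0`-type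
ranges only if one `K` serves all of `(0, 1]`; for the record, `RelEdgeMassLaw` itself quantifies `0 < b₀`
first, and (T1) shows this order cannot be exchanged. -/
theorem not_relEdgeMassLawOn_zero_one : ¬ RelEdgeMassLawOn 0 1 := by
  rintro ⟨K, hK0, hK⟩
  refine relEdgeMassLaw_false_without_floor ⟨K, hK0, fun η hη ↦ ?_⟩
  obtain ⟨r₀, hr₀, hr₀1, h⟩ := hK η hη
  exact ⟨r₀, hr₀, hr₀1, fun a r u ha ha1 hu hr hrr ↦ h a r u ha.le ha1 hu hr hrr⟩

/-- **(T2) At a window with `ε(a) ≤ 0`, B♭ forces flat edges**: every ground state `u` of that window has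
`∫_{a−r<|x|} ‖u‖² ≤ η r / log(1/r)` for every `η > 0` and all small `r` — edge mass `o(r/log(1/r))`, i.e.
a VANISHING edge coefficient `T_a = 0` in the profile `u ~ T (log(1/(a−|x|)))^{-1/2}`. This is where the
RH-content of B♭ sits (`0 ≤ K` is used: `K ε(a) ≤ 0`). -/
theorem RelEdgeMassLawOn.flat_of_nonpos {b₀ A : ℝ} (hB : RelEdgeMassLawOn b₀ A) {a : ℝ}
    (ha : b₀ ≤ a) (haA : a ≤ A) (hε : ε a ≤ 0) :
    ∀ η : ℝ, 0 < η → ∃ r₀ : ℝ, 0 < r₀ ∧ r₀ < 1 ∧ ∀ (r : ℝ) (u : ℝ → ℂ), IsWeilGroundState a u →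
      0 < r → r ≤ r₀ → ∫ x in {x : ℝ | a - r < |x|}, ‖u x‖ ^ 2 ≤ η * r / Real.log (1 / r) := by
  intro η hη
  obtain ⟨K, hK0, hK⟩ := hB
  obtain ⟨r₀, hr₀, hr₀1, h⟩ := hK η hη
  refine ⟨r₀, hr₀, hr₀1, fun r u hu hr hrr ↦ (h a r u ha haA hu hr hrr).trans ?_⟩
  have hlog : 0 < Real.log (1 / r) := log_one_div_pos hr (lt_of_le_of_lt hrr hr₀1)
  apply div_le_div_of_nonneg_right _ hlog.le
  apply mul_le_mul_of_nonneg_right _ hr.le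
  nlinarith [mul_nonpos_of_nonneg_of_nonpos hK0 hε]

/-- **Hopf-type edge non-degeneracy at the window `a`** — the hypothesis `H` of the negative lemma below; NOT
a tree fact. It says: no ground state of the window `a` has edge mass `o(r/log(1/r))` (in the profile
`u ~ T (log(1/(a−|x|)))^{-1/2}`: `T ≠ 0`). Model: the Hopf lemma for the logarithmic Laplacian
(Hernández-Santamaría–Ríos–Saldaña, arXiv:2401.18033, "Optimal boundary regularity and a Hopf-type lemma
for Dirichlet problems involving the logarithmic Laplacian", Thm 1.2-type statement for non-negative
supersolutions); for Weil ground states one also needs a sign (Perron–Frobenius for the window form: the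
archimedean part is a Markov form, `WeilMarkovQuadratic`, and the prime shifts reward `|u|`), which is why
this is an `H` and not a theorem. [topic: Weil ground states, edge behaviour] -/
def HopfEdge (a : ℝ) : Prop :=
  ∀ u : ℝ → ℂ, IsWeilGroundState a u → ∃ c : ℝ, 0 < c ∧ ∀ r₀ : ℝ, 0 < r₀ →
    ∃ r : ℝ, 0 < r ∧ r ≤ r₀ ∧ c * r / Real.log (1 / r) ≤ ∫ x in {x : ℝ | a - r < |x|}, ‖u x‖ ^ 2

/-- **(T2′) B♭ + Hopf ⇒ positivity of the bottom** on the range: at a window with `ε(a) ≤ 0` a ground state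
exists (`ConnesConsaniMoscovici2025_thm_3_6_holds.exists_isWeilGroundState`, PROVED) and its Hopf constant
`c` beats the flat-edge bound at `η = c/2`. -/
theorem pos_of_relEdgeMassLawOn_of_hopfEdge {b₀ A a : ℝ} (hb₀ : 0 < b₀) (hB : RelEdgeMassLawOn b₀ A)
    (ha : b₀ ≤ a) (haA : a ≤ A) (hH : HopfEdge a) : 0 < ε a := by
  by_contra hle
  push Not at hle
  obtain ⟨u, hu⟩ :=
    ConnesConsaniMoscovici2025_thm_3_6_holds.exists_isWeilGroundState (lt_of_lt_of_le hb₀ ha)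
  obtain ⟨c, hc, hHu⟩ := hH u hu
  obtain ⟨r₀, hr₀, hr₀1, hflat⟩ := hB.flat_of_nonpos ha haA hle (c / 2) (by positivity)
  obtain ⟨r, hr, hrr, hlow⟩ := hHu r₀ hr₀
  have hlog : 0 < Real.log (1 / r) := log_one_div_pos hr (lt_of_le_of_lt hrr hr₀1)
  have h := hlow.trans (hflat r u hu hr hrr)
  rw [mul_div_assoc, mul_div_assoc] at h
  have hpos : 0 < r / Real.log (1 / r) := by positivity
  nlinarith

/-- **(T2″) Stub B♭ is RH-strength BY ITSELF, modulo a Hopf-type edge lemma** (no E♭, no cut, no glue):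
`(∀ a > 0, HopfEdge a) → RelEdgeMassLaw → RiemannHypothesis` (positivity of every bottom is Weil positivity
on every window, `weilGroundEnergy_nonneg_iff_holds`; Yoshida's criterion
`riemannHypothesis_iff_forall_weilPositivityOn`). Negative lemma modulo `H = ∀ a > 0, HopfEdge a`:
under `H`, `¬RH → ¬B♭`. -/
theorem riemannHypothesis_of_relEdgeMassLaw_of_hopfEdge (hH : ∀ a : ℝ, 0 < a → HopfEdge a)
    (hB : RelEdgeMassLaw) : RiemannHypothesis :=
  riemannHypothesis_iff_forall_weilPositivityOn.2 fun a ha ↦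
    (weilGroundEnergy_nonneg_iff_holds ha).1
      (pos_of_relEdgeMassLawOn_of_hopfEdge ha (hB a a ha le_rfl) le_rfl le_rfl (hH a ha)).le

/-- **B♭ contains the absolute law** on the same range (take `η = 1`, `K_abs = K · max(ε(b₀), 0) + 1`,
`ε` antitone) — same as the skeleton's `absEdgeMassLaw_of_rel`, recorded here for the calibration. -/
theorem absEdgeMassLawOn_of_rel {b₀ A : ℝ} (hb₀ : 0 < b₀) (hB : RelEdgeMassLawOn b₀ A) :
    AbsEdgeMassLawOn b₀ A := by
  obtain ⟨K, hK0, hK⟩ := hB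
  obtain ⟨r₀, hr₀, hr₀1, h1⟩ := hK 1 one_pos
  refine ⟨K * max (ε b₀) 0 + 1, r₀, hr₀, hr₀1, fun a r u ha haA hu hr hrd ↦ (h1 a r u ha haA hu hr hrd).trans ?_⟩
  have hlog : 0 < Real.log (1 / r) := log_one_div_pos hr (lt_of_le_of_lt hrd hr₀1)
  apply div_le_div_of_nonneg_right _ hlog.le
  apply mul_le_mul_of_nonneg_right _ hr.le
  have e : ε a ≤ max (ε b₀) 0 :=
    (eps_antitoneOn hb₀ (lt_of_lt_of_le hb₀ ha) ha).trans (le_max_left _ _)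
  nlinarith [mul_le_mul_of_nonneg_left e hK0]

/-- **Converse calibration: `RH ∧ (absolute edge-mass law) ⇒ B♭`** on the same range. Under RH every bottom is
strictly positive (`strictUnderRH_proof`, PROVED) and `ε` is continuous (PROVED), so `m := min_{[b₀,A]} ε > 0`
and `K := max(K_abs, 0)/m` works for every `η`. Together with (T2″) and `absEdgeMassLawOn_of_rel`: up to the
Hopf lemma, B♭ ≡ RH ∧ (the sibling line's unconditional regularity bet). -/
theorem relEdgeMassLawOn_of_rh_of_abs {b₀ A : ℝ} (hb₀ : 0 < b₀) (hA : b₀ ≤ A) (hRH : RiemannHypothesis)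
    (hAbs : AbsEdgeMassLawOn b₀ A) : RelEdgeMassLawOn b₀ A := by
  obtain ⟨K, d₀, hd₀, hd₀1, hK⟩ := hAbs
  have hpos : ∀ a : ℝ, 0 < a → 0 < ε a :=
    _root_.Summit.RiemannHypothesis.RiemannHypothesis.Theorems.strictUnderRH_proof
      (_root_.Summit.RiemannHypothesis_iff.2 hRH)
  obtain ⟨a₀, ha₀, hmin⟩ := (isCompact_Icc (a := b₀) (b := A)).exists_isMinOn
    (nonempty_Icc.2 hA) (continuousOn_eps hb₀)
  have hm : 0 < ε a₀ := hpos a₀ (lt_of_lt_of_le hb₀ ha₀.1)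
  refine ⟨max K 0 / ε a₀, by positivity, fun η hη ↦ ⟨d₀, hd₀, hd₀1, fun a r u ha haA hu hr hrd ↦
    (hK a r u ha haA hu hr hrd).trans ?_⟩⟩
  have hlog : 0 < Real.log (1 / r) := log_one_div_pos hr (lt_of_le_of_lt hrd hd₀1)
  apply div_le_div_of_nonneg_right _ hlog.le
  apply mul_le_mul_of_nonneg_right _ hr.le
  have h1 : ε a₀ ≤ ε a := hmin ⟨ha, haA⟩
  have h2 : 0 ≤ max K 0 / ε a₀ := by positivity
  calc K ≤ max K 0 := le_max_left _ _
    _ = max K 0 / ε a₀ * ε a₀ := by field_simp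
    _ ≤ max K 0 / ε a₀ * ε a := by gcongr
    _ ≤ max K 0 / ε a₀ * ε a + η := by linarith

/-- The CONCLUSION `X` of Stub E♭ (`stub_relCommutatorBound : B♭ → X`), verbatim: the right-hand side of the
landed localised cut inequality is `≤ h (K ε(a) + η)` for admissible collar cutoffs, and `∫‖χu‖² ≥ 1/2`. -/
def RelCommutatorConclusion : Prop :=
  ∀ b₀ A : ℝ, 0 < b₀ → b₀ ≤ A → ∃ K : ℝ, 0 ≤ K ∧ ∀ η : ℝ, 0 < η → ∃ h₀ : ℝ, 0 < h₀ ∧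
    ∀ (a h : ℝ) (u : ℝ → ℂ) (χ : ℝ → ℝ), b₀ ≤ a → a ≤ A → 0 < h → h ≤ h₀ →
    IsWeilGroundState a u → (∀ x y, |χ x - χ y| ≤ |x - y| / h) → (∀ x, 0 ≤ χ x ∧ χ x ≤ 1) →
    (∀ x, |x| ≤ a - 2 * h → χ x = 1) → (∀ x, a - h ≤ |x| → χ x = 0) →
    (∫ t in Ioi (0 : ℝ), weilArchDensity t *
          ∫ x, (χ (x + t) - χ x) ^ 2 * (‖u (x + t)‖ * ‖u x‖)) +
      (∑ n ∈ weilPrimeIndex a, (ArithmeticFunction.vonMangoldt n : ℝ) / Real.sqrt n *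
          ∫ x, (χ (x + Real.log n) - χ x) ^ 2 * (‖u (x + Real.log n)‖ * ‖u x‖)) +
      2 * ‖∫ t, ((1 - χ t : ℝ) : ℂ) * u t * (Real.cosh (t / 2) : ℂ)‖ ^ 2 +
      2 * ‖∫ t, u t * (Real.cosh (t / 2) : ℂ)‖ *
          ‖∫ t, (((1 - χ t) ^ 2 : ℝ) : ℂ) * u t * (Real.cosh (t / 2) : ℂ)‖ +
      2 * ‖∫ t, u t * (Real.sinh (t / 2) : ℂ)‖ *
          ‖∫ t, (((1 - χ t) ^ 2 : ℝ) : ℂ) * u t * (Real.sinh (t / 2) : ℂ)‖ ≤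
        h * (K * ε a + η) ∧
      1 / 2 ≤ ∫ x, ‖(χ x : ℂ) * u x‖ ^ 2

/-- **(T3) The conclusion `X` of Stub E♭ alone proves the crux** — by the LANDED cut
`Theorems.WeilWindowFlowWindowLipschitz.stub_localizedCut` (with its landed antecedents `stub_formDomainPos`,
`stub_groundStateEnergy`, `stub_eulerLagrange`) and the skeleton's glue (collar cutoff of width
`h = min(h₀, δ/2, 1/2)` at the big window `a + h`, ground state of the big window, division by `∫‖χu‖² ≥ 1/2`,
antitonicity). The glue is re-proved here verbatim from `Lines/collar_cut_edge_mass.lean`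
(`diniLeakage_of_relOneStep`) so that this file does not import a sorried module. -/
theorem diniLeakage_of_relCommutatorConclusion (hE : RelCommutatorConclusion) :
    WeilWindowFlow.DiniLeakage := by
  have hC1 := _root_.Summit.RiemannHypothesis.RiemannHypothesis.Theorems.WeilWindowFlowWindowLipschitz.stub_formDomainPos
  have hC2 := _root_.Summit.RiemannHypothesis.RiemannHypothesis.Theorems.WeilWindowFlowWindowLipschitz.stub_groundStateEnergy
  have hEL :=
    _root_.Summit.RiemannHypothesis.RiemannHypothesis.Theorems.WeilWindowFlowWindowLipschitz.stub_eulerLagrange hC1 hC2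
  have hD :=
    _root_.Summit.RiemannHypothesis.RiemannHypothesis.Theorems.WeilWindowFlowWindowLipschitz.stub_localizedCut hC1 hC2 hEL
  intro b₀ A hb₀ hb₀A
  obtain ⟨K, hK0, hK⟩ := hE b₀ (A + 1) hb₀ (by linarith)
  refine ⟨2 * K, ?_⟩
  intro a ha haA η δ hη hδ
  obtain ⟨h₀, hh₀, hest⟩ := hK (η / 2) (by positivity)
  set h : ℝ := min h₀ (min (δ / 2) (1 / 2)) with hhdef
  have hh : 0 < h := lt_min hh₀ (lt_min (by positivity) (by norm_num))
  have hhh₀ : h ≤ h₀ := min_le_left _ _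
  have hhδ : h < δ := by
    have h1 : h ≤ δ / 2 := (min_le_right _ _).trans (min_le_left _ _)
    linarith
  refine ⟨h, hh, hhδ, ?_⟩
  have ha0 : 0 < a := lt_of_lt_of_le hb₀ ha
  set b : ℝ := a + h with hbdef
  have hab : a ≤ b := by simp only [hbdef]; linarith
  have hb0 : 0 < b := lt_of_lt_of_le ha0 hab
  have hb₀b : b₀ ≤ b := ha.trans hab
  have hbA : b ≤ A + 1 := by
    have : h ≤ 1 / 2 := (min_le_right _ _).trans (min_le_right _ _)
    simp only [hbdef]; linarith
  obtain ⟨u, hu⟩ := ConnesConsaniMoscovici2025_thm_3_6_holds.exists_isWeilGroundState hb0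
  set χ : ℝ → ℝ := fun x ↦ max (min ((b - h - |x|) / h) 1) 0 with hχdef
  have hχ01 : ∀ x, 0 ≤ χ x ∧ χ x ≤ 1 := fun x ↦
    ⟨le_max_right _ _, max_le (min_le_right _ _) zero_le_one⟩
  have hχone : ∀ x, |x| ≤ b - 2 * h → χ x = 1 := by
    intro x hx
    have h1p : 1 ≤ (b - h - |x|) / h := by
      rw [le_div_iff₀ hh]
      linarith
    show max (min ((b - h - |x|) / h) 1) 0 = 1
    rw [min_eq_right h1p, max_eq_left (zero_le_one' ℝ)]
  have hχzero : ∀ x, b - h ≤ |x| → χ x = 0 := by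
    intro x hx
    have hp : (b - h - |x|) / h ≤ 0 := by
      rw [div_le_iff₀ hh, zero_mul]
      linarith
    show max (min ((b - h - |x|) / h) 1) 0 = 0
    exact max_eq_right ((min_le_left _ _).trans hp)
  have hχzero' : ∀ x, a ≤ |x| → χ x = 0 := fun x hx ↦
    hχzero x (by simp only [hbdef]; linarith)
  have hχlip : ∀ x y, |χ x - χ y| ≤ |x - y| / h := by
    intro x y
    calc |χ x - χ y|
        = |max (min ((b - h - |x|) / h) 1) 0 - max (min ((b - h - |y|) / h) 1) 0| := rfl
      _ ≤ |min ((b - h - |x|) / h) 1 - min ((b - h - |y|) / h) 1| := abs_max_sub_max_le_abs _ _ _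
      _ ≤ max |(b - h - |x|) / h - (b - h - |y|) / h| |(1 : ℝ) - 1| := abs_min_sub_min_le_max _ _ _ _
      _ = |(b - h - |x|) / h - (b - h - |y|) / h| := by
          rw [sub_self, abs_zero, max_eq_left (abs_nonneg _)]
      _ = |(|y| - |x|)| / h := by
          rw [show (b - h - |x|) / h - (b - h - |y|) / h = (|y| - |x|) / h by ring, abs_div,
            abs_of_pos hh]
      _ ≤ |x - y| / h := by
          rw [div_le_div_iff_of_pos_right hh, abs_sub_comm x y]
          exact abs_abs_sub_abs_le_abs_sub y x
  have hχLW : LipschitzWith (Real.toNNReal (1 / h)) χ := by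
    refine LipschitzWith.of_dist_le_mul fun x y ↦ ?_
    rw [Real.dist_eq, Real.dist_eq, Real.coe_toNNReal _ (by positivity)]
    calc |χ x - χ y| ≤ |x - y| / h := hχlip x y
      _ = 1 / h * |x - y| := by ring
  have hcut := hD b a (Real.toNNReal (1 / h)) u χ ha0 hab hu hχLW hχ01 hχzero'
  obtain ⟨hR, hm⟩ := hest b h u χ hb₀b hbA hh hhh₀ hu hχlip hχ01 hχone hχzero
  have hanti : 0 ≤ ε a - ε b := eps_sub_nonneg ha0 hh.le
  have hεba : ε b ≤ ε a := by linarith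
  have h1 : (ε a - ε b) * (1 / 2) ≤ h * (K * ε b + η / 2) :=
    le_trans (mul_le_mul_of_nonneg_left hm hanti) (hcut.trans hR)
  have h3 : h * (K * ε b) ≤ h * (K * ε a) :=
    mul_le_mul_of_nonneg_left (mul_le_mul_of_nonneg_left hεba hK0) hh.le
  nlinarith

/-- **(T3′) Hence `X` alone decides RH**: Stub E♭ (`B♭ → X`) is an implication between two RH-strength
statements; it is "unconditional" only as a TRANSFER (under `¬RH`, E♭ holds iff B♭ fails). -/
theorem riemannHypothesis_of_relCommutatorConclusion (hE : RelCommutatorConclusion) : RiemannHypothesis :=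
  riemannHypothesis_of_diniLeakage (diniLeakage_of_relCommutatorConclusion hE)

/-- **(T4) The width bound `h₀` of `X` must undercut the floor: `h₀ < b₀`.** At `a = b₀` and `h = b₀ ≤ h₀` the
zero cutoff is admissible (all four cutoff clauses hold, the "= 1" clause vacuously since `a − 2h < 0`) and
`∫‖0·u‖² = 0 < 1/2`. Harmless (the skeleton's `h₀(η, b₀, A)` may depend on `b₀`), recorded as the cheapest
degenerate instance checked. -/
theorem relCommutatorConclusion_h0_lt_floor {b₀ A K h₀ : ℝ} (hb₀ : 0 < b₀) (hA : b₀ ≤ A)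
    (hX : ∀ η : ℝ, 0 < η → ∀ (a h : ℝ) (u : ℝ → ℂ) (χ : ℝ → ℝ), b₀ ≤ a → a ≤ A → 0 < h → h ≤ h₀ →
      IsWeilGroundState a u → (∀ x y, |χ x - χ y| ≤ |x - y| / h) → (∀ x, 0 ≤ χ x ∧ χ x ≤ 1) →
      (∀ x, |x| ≤ a - 2 * h → χ x = 1) → (∀ x, a - h ≤ |x| → χ x = 0) →
      (∫ t in Ioi (0 : ℝ), weilArchDensity t *
            ∫ x, (χ (x + t) - χ x) ^ 2 * (‖u (x + t)‖ * ‖u x‖)) +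
        (∑ n ∈ weilPrimeIndex a, (ArithmeticFunction.vonMangoldt n : ℝ) / Real.sqrt n *
            ∫ x, (χ (x + Real.log n) - χ x) ^ 2 * (‖u (x + Real.log n)‖ * ‖u x‖)) +
        2 * ‖∫ t, ((1 - χ t : ℝ) : ℂ) * u t * (Real.cosh (t / 2) : ℂ)‖ ^ 2 +
        2 * ‖∫ t, u t * (Real.cosh (t / 2) : ℂ)‖ *
            ‖∫ t, (((1 - χ t) ^ 2 : ℝ) : ℂ) * u t * (Real.cosh (t / 2) : ℂ)‖ +
        2 * ‖∫ t, u t * (Real.sinh (t / 2) : ℂ)‖ *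
            ‖∫ t, (((1 - χ t) ^ 2 : ℝ) : ℂ) * u t * (Real.sinh (t / 2) : ℂ)‖ ≤
          h * (K * ε a + η) ∧
        1 / 2 ≤ ∫ x, ‖(χ x : ℂ) * u x‖ ^ 2) :
    h₀ < b₀ := by
  by_contra hle
  push Not at hle
  obtain ⟨u, hu⟩ := ConnesConsaniMoscovici2025_thm_3_6_holds.exists_isWeilGroundState hb₀
  have h := (hX 1 one_pos b₀ b₀ u (fun _ ↦ 0) le_rfl hA hb₀ hle hu
    (fun x y ↦ by simp only [sub_self, abs_zero]; positivity)
    (fun _ ↦ ⟨le_rfl, zero_le_one⟩)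
    (fun x hx ↦ by exfalso; linarith [abs_nonneg x])
    (fun _ _ ↦ rfl)).2
  simp at h
  linarith

end Summit.RiemannHypothesis.RiemannHypothesis.Cruxes.DiniLeakage.Disproof

end
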